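import Mathlib.Geometry.Euclidean.Inversion.Calculus
import Literature.Topology.FourManifolds.StereographicInversion
import Literature.Topology.FourManifolds.ConnectedSumData
import Literature.Geometry.Manifold.CompactChartDomainEmbedding

/-!
# Helper `helper_antipodalChartPair` of line `stable-seam-host` for crux `OrigamiFoldExistence`
(item stmt-SmoothPoincare4-7844; lead c10, wave 1)

Third brick of `helper_stableSeamHypotheses_inhabited`: **the genuine ball of `S⁴` and the chart
around its complement.**  For a point `q` of the round `S⁴ ⊂ ℝ⁵`:

* `e := (chartAt q)⁻¹ : ℝ⁴ → S⁴` (Mathlib's inverse stereographic chart, projection from `-q`) is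
  a smooth embedding of the whole model space (tree lemma
  `isSmoothEmbedding_symm_of_target_eq_univ`), `e 0 = q`;
* `π := ¼ • chartAt (-q)` (projection from `q`, rescaled from Mathlib's radius-`2` convention) is
  `C^∞`, injective, with bijective differential on `U := {x ≠ q | ‖π x‖ < 3/2}`, an open set
  containing the "fake ball" `S⁴ ∖ e(B⁴)` and mapped by `π` into the ball of radius `2`;
* on `ℝ⁴ ∖ {0}` the transition `π ∘ e` is `L ∘ ι`, `ι(w) = w/‖w‖²` the inversion and `L` a linear
  isometry of `ℝ⁴` (tree theorem `chartAt_sphere_neg_eq`: antipodal stereographic charts differ by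
  `4 • L ∘ ι`), so on the unit sphere `π (e u) = L u` and `d(π ∘ e)_u v = L v` for `v ⊥ u`
  (the differential of `ι` at a unit vector is the reflection in `u^⊥`, Mathlib's
  `EuclideanGeometry.hasFDerivAt_inversion`).

Def-free (the maps enter the private lemmas as variables with defining equations; the registered
statement is an existence).  Sources: Hirsch, *Differential Topology* (1976), §1.1 (stereographic
atlas, transition `x ↦ x/‖x‖²`); Lee, *Introduction to Smooth Manifolds* (2013), Problem 1-7.
-/

noncomputable section

-- the prescribed namespace `Summit.<P>.<Sub>.…` duplicates `SmoothPoincare4` (P = Sub)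
set_option linter.dupNamespace false

open scoped Manifold ContDiff Topology RealInnerProductSpace
open Set Function Metric
open Literature.Topology.FourManifolds

namespace Summit.SmoothPoincare4.SmoothPoincare4.Theorems.OrigamiFoldExistence.StableSeamHost

/-- In the boundaryless model `𝓡 4` the extended chart is the chart. [folklore] -/
private theorem extChartAt_eq_chartAt {M : Type*} [TopologicalSpace M]
    [ChartedSpace (EuclideanSpace ℝ (Fin 4)) M] (p x : M) :
    extChartAt (𝓡 4) p x = chartAt (EuclideanSpace ℝ (Fin 4)) p x := by
  simp only [extChartAt_coe, Function.comp_apply, modelWithCornersSelf_coe, id_eq]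

section Pair

variable (q : Metric.sphere (0 : EuclideanSpace ℝ (Fin 5)) 1)
  {c : EuclideanSpace ℝ (Fin 4) →L[ℝ] EuclideanSpace ℝ (Fin 4)} (hc : ∀ y, c y = (4 : ℝ)⁻¹ • y)
  {π : Metric.sphere (0 : EuclideanSpace ℝ (Fin 5)) 1 → EuclideanSpace ℝ (Fin 4)}
  (hπ : ∀ x, π x = c (extChartAt (𝓡 4) (-q) x))

/-! ### The chart ball `e = (chartAt q)⁻¹` -/

/-- **The inverse chart of `S⁴` at `q` is a smooth embedding `ℝ⁴ → S⁴`** (a chart of the maximal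
atlas with target `univ`; tree lemma `isSmoothEmbedding_symm_of_target_eq_univ`). [folklore] -/
private theorem isSmoothEmbedding_chartAt_symm :
    Manifold.IsSmoothEmbedding (𝓡 4) (𝓡 4) ∞ (chartAt (EuclideanSpace ℝ (Fin 4)) q).symm := by
  haveI : Fact (Module.finrank ℝ (EuclideanSpace ℝ (Fin 5)) = 4 + 1) := ⟨finrank_euclideanSpace_fin⟩
  exact isSmoothEmbedding_symm_of_target_eq_univ
    (IsManifold.chart_mem_maximalAtlas (I := 𝓡 4) (n := ∞) q) (chartAt_sphere_target q)

/-- `e w` lies in the chart domain `{-q}ᶜ` and `chartAt q (e w) = w`. [folklore] -/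
private theorem chartAt_symm_mem (w : EuclideanSpace ℝ (Fin 4)) :
    (chartAt (EuclideanSpace ℝ (Fin 4)) q).symm w ∈ (chartAt (EuclideanSpace ℝ (Fin 4)) q).source ∧
      chartAt (EuclideanSpace ℝ (Fin 4)) q ((chartAt (EuclideanSpace ℝ (Fin 4)) q).symm w) = w := by
  haveI : Fact (Module.finrank ℝ (EuclideanSpace ℝ (Fin 5)) = 4 + 1) := ⟨finrank_euclideanSpace_fin⟩
  have hw : w ∈ (chartAt (EuclideanSpace ℝ (Fin 4)) q).target := by
    rw [chartAt_sphere_target]; exact mem_univ w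
  exact ⟨(chartAt _ q).map_target hw, (chartAt _ q).right_inv hw⟩

/-- `e w ≠ -q`, and `e w ≠ q` for `w ≠ 0`. [folklore] -/
private theorem chartAt_symm_ne {w : EuclideanSpace ℝ (Fin 4)} (hw : w ≠ 0) :
    (chartAt (EuclideanSpace ℝ (Fin 4)) q).symm w ≠ q ∧
      (chartAt (EuclideanSpace ℝ (Fin 4)) q).symm w ≠ -q := by
  haveI : Fact (Module.finrank ℝ (EuclideanSpace ℝ (Fin 5)) = 4 + 1) := ⟨finrank_euclideanSpace_fin⟩
  obtain ⟨hmem, hright⟩ := chartAt_symm_mem q w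
  refine ⟨fun h => hw ?_, fun h => ?_⟩
  · rw [← hright, h, chartAt_sphere_apply_self]
  · rw [chartAt_sphere_source] at hmem
    exact hmem h

/-! ### The rescaled antipodal chart `π = ¼ • chartAt (-q)` -/

include hc in
/-- The rescaling `c = ¼ • id` is bijective. [folklore] -/
private theorem bijective_c : Bijective c := by
  refine ⟨(injective_iff_map_eq_zero _).2 fun y hy => ?_, fun y => ⟨(4 : ℝ) • y, ?_⟩⟩
  · rw [hc] at hy
    simpa using hy
  · rw [hc, smul_smul]; norm_num

include hπ in
/-- `π` is `C^∞` on the chart domain of `-q`. [folklore] -/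
private theorem contMDiffOn_pi :
    ContMDiffOn (𝓡 4) (𝓡 4) ∞ π (chartAt (EuclideanSpace ℝ (Fin 4)) (-q)).source := by
  rw [show π = fun x => c (extChartAt (𝓡 4) (-q) x) from funext hπ]
  exact c.contMDiff.comp_contMDiffOn contMDiffOn_extChartAt

include hc hπ in
/-- `π` is injective on the chart domain of `-q`. [folklore] -/
private theorem injOn_pi : InjOn π (chartAt (EuclideanSpace ℝ (Fin 4)) (-q)).source := by
  intro x hx y hy h
  rw [hπ, hπ] at h
  have h' := (bijective_c hc).1 h
  rw [← extChartAt_source (𝓡 4)] at hx hy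
  exact (extChartAt (𝓡 4) (-q)).injOn hx hy h'

include hc hπ in
/-- `π` has bijective differential on the chart domain of `-q`. [folklore] -/
private theorem bijective_mfderiv_pi {x : Metric.sphere (0 : EuclideanSpace ℝ (Fin 5)) 1}
    (hx : x ∈ (chartAt (EuclideanSpace ℝ (Fin 4)) (-q)).source) :
    Bijective (mfderiv (𝓡 4) (𝓡 4) π x) := by
  have hx' : x ∈ (extChartAt (𝓡 4) (-q)).source := by rwa [extChartAt_source]
  have hd : HasMFDerivAt (𝓡 4) (𝓡 4) (extChartAt (𝓡 4) (-q)) x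
      (mfderiv (𝓡 4) (𝓡 4) (extChartAt (𝓡 4) (-q)) x) :=
    ((contMDiffOn_extChartAt (n := ∞)).contMDiffAt ((chartAt _ (-q)).open_source.mem_nhds hx)
      |>.mdifferentiableAt (by simp)).hasMFDerivAt
  have hπ' : π = fun x => c (extChartAt (𝓡 4) (-q) x) := funext hπ
  subst hπ'
  have hcomp : HasMFDerivAt (𝓡 4) (𝓡 4) (fun x => c (extChartAt (𝓡 4) (-q) x)) x
      (c.comp (mfderiv (𝓡 4) (𝓡 4) (extChartAt (𝓡 4) (-q)) x)) :=
    (c.hasMFDerivAt (x := extChartAt (𝓡 4) (-q) x)).comp x hd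
  rw [hcomp.mfderiv]
  exact (bijective_c hc).comp (Literature.Geometry.Manifold.bijective_mfderiv_extChartAt hx')

section Transfer

variable [Fact (Module.finrank ℝ (EuclideanSpace ℝ (Fin 5)) = 4 + 1)]

include hc hπ in
/-- **The transition `π ∘ e = L ∘ ι`**: for `x ≠ ±q`, `π x = L (ι (chartAt q x))` with
`L = stereoTransfer q` a linear isometry and `ι` the inversion (tree `chartAt_sphere_neg_eq`).
[folklore] -/
private theorem pi_eq_transfer {x : Metric.sphere (0 : EuclideanSpace ℝ (Fin 5)) 1} (hxq : x ≠ q)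
    (hxq' : x ≠ -q) :
    π x = stereoTransfer (n := 4) q (sphereInversion (chartAt (EuclideanSpace ℝ (Fin 4)) q x)) := by
  rw [hπ, extChartAt_eq_chartAt, chartAt_sphere_neg_eq q x hxq hxq',
    map_smul, hc, smul_smul]
  norm_num

include hc hπ in
/-- `π (e w) = L (ι w)` for `w ≠ 0`. [folklore] -/
private theorem pi_chartAt_symm {w : EuclideanSpace ℝ (Fin 4)} (hw : w ≠ 0) :
    π ((chartAt (EuclideanSpace ℝ (Fin 4)) q).symm w) =
      stereoTransfer (n := 4) q (sphereInversion w) := by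
  obtain ⟨h1, h2⟩ := chartAt_symm_ne q hw
  rw [pi_eq_transfer q hc hπ h1 h2, (chartAt_symm_mem q w).2]

end Transfer

include hπ in
/-- `π (-q) = 0`. [folklore] -/
private theorem pi_neg : π (-q) = 0 := by
  haveI : Fact (Module.finrank ℝ (EuclideanSpace ℝ (Fin 5)) = 4 + 1) := ⟨finrank_euclideanSpace_fin⟩
  rw [hπ, extChartAt_eq_chartAt, chartAt_sphere_apply_self, map_zero]

/-! ### The neighbourhood `U` of the fake ball -/

include hπ in
/-- `U = {x ≠ q | ‖π x‖ < 3/2}` is open. [folklore] -/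
private theorem isOpen_U :
    IsOpen ((chartAt (EuclideanSpace ℝ (Fin 4)) (-q)).source ∩ π ⁻¹' ball 0 (3 / 2)) :=
  (contMDiffOn_pi q hπ).continuousOn.isOpen_inter_preimage (chartAt _ (-q)).open_source
    isOpen_ball

section Transfer'

variable [Fact (Module.finrank ℝ (EuclideanSpace ℝ (Fin 5)) = 4 + 1)]

include hc hπ in
/-- **The fake ball lies in `U`**: a point outside `e(B⁴)` is `-q` (where `π = 0`) or `e w` with
`‖w‖ ≥ 1`, where `‖π (e w)‖ = ‖w‖⁻¹ ≤ 1`. [folklore] -/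
private theorem compl_image_ball_subset_U :
    ((chartAt (EuclideanSpace ℝ (Fin 4)) q).symm '' ball (0 : EuclideanSpace ℝ (Fin 4)) 1)ᶜ ⊆
      (chartAt (EuclideanSpace ℝ (Fin 4)) (-q)).source ∩ π ⁻¹' ball 0 (3 / 2) := by
  intro x hx
  by_cases hxq : x = -q
  · subst hxq
    refine ⟨mem_chart_source _ _, ?_⟩
    rw [mem_preimage, pi_neg q hπ]
    exact mem_ball_self (by norm_num)
  · -- `x = e w` with `w = chartAt q x`, `‖w‖ ≥ 1`
    have hxs : x ∈ (chartAt (EuclideanSpace ℝ (Fin 4)) q).source := by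
      rw [chartAt_sphere_source]; exact hxq
    set w := chartAt (EuclideanSpace ℝ (Fin 4)) q x with hw
    have hex : (chartAt (EuclideanSpace ℝ (Fin 4)) q).symm w = x := (chartAt _ q).left_inv hxs
    have hw1 : 1 ≤ ‖w‖ := by
      by_contra h
      exact hx ⟨w, mem_ball_zero_iff.2 (not_le.1 h), hex⟩
    have hw0 : w ≠ 0 := by
      intro h0; rw [h0, norm_zero] at hw1; exact absurd hw1 (by norm_num)
    obtain ⟨h1, h2⟩ := chartAt_symm_ne q hw0
    rw [hex] at h1 h2
    refine ⟨?_, ?_⟩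
    · rw [chartAt_sphere_source, neg_neg]; exact h1
    · rw [mem_preimage, ← hex, pi_chartAt_symm q hc hπ hw0, mem_ball_zero_iff,
        LinearIsometryEquiv.norm_map, sphereInversion.norm_apply]
      calc ‖w‖⁻¹ ≤ 1 := inv_le_one_of_one_le₀ hw1
        _ < 3 / 2 := by norm_num

/-! ### The seam: `π ∘ e` on the unit sphere -/

include hc hπ in
/-- On the unit sphere `π (e u) = L u` (`ι u = u`). [folklore] -/
private theorem pi_chartAt_symm_unit {u : EuclideanSpace ℝ (Fin 4)} (hu : ‖u‖ = 1) :
    π ((chartAt (EuclideanSpace ℝ (Fin 4)) q).symm u) = stereoTransfer (n := 4) q u := by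
  have hu0 : u ≠ 0 := by
    intro h; rw [h, norm_zero] at hu; exact zero_ne_one hu
  rw [pi_chartAt_symm q hc hπ hu0, sphereInversion.apply_def, hu]
  simp

include hc hπ in
/-- **The differential of the seam `π ∘ e` at a unit vector is `L` on `u^⊥`**: near `u`,
`π ∘ e = L ∘ ι` and `dι_u` is the reflection in `u^⊥` (Mathlib's `hasFDerivAt_inversion`).
[folklore] -/
private theorem hasMFDerivAt_pi_chartAt_symm {u : EuclideanSpace ℝ (Fin 4)} (hu : ‖u‖ = 1) :
    HasMFDerivAt (𝓡 4) (𝓡 4) (π ∘ (chartAt (EuclideanSpace ℝ (Fin 4)) q).symm) u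
      ((stereoTransfer (n := 4) q).toContinuousLinearEquiv.toContinuousLinearMap.comp
        ((ℝ ∙ u)ᗮ.reflection.toContinuousLinearEquiv.toContinuousLinearMap)) := by
  have hu0 : u ≠ 0 := by
    intro h; rw [h, norm_zero] at hu; exact zero_ne_one hu
  -- `ι` near `u`
  have hι : HasFDerivAt (sphereInversion (F := EuclideanSpace ℝ (Fin 4)))
      ((ℝ ∙ u)ᗮ.reflection.toContinuousLinearEquiv.toContinuousLinearMap) u := by
    have h := EuclideanGeometry.hasFDerivAt_inversion (c := (0 : EuclideanSpace ℝ (Fin 4)))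
      (R := 1) hu0
    rw [← sphereInversion.eq_inversion] at h
    simpa [hu] using h
  have hL := ((stereoTransfer (n := 4) q).toContinuousLinearEquiv.hasFDerivAt
    (x := sphereInversion u)).comp u hι
  have hmf := hasMFDerivAt_iff_hasFDerivAt.2 hL
  refine hmf.congr_of_eventuallyEq ?_
  filter_upwards [isOpen_compl_singleton.mem_nhds hu0] with w hw
  exact pi_chartAt_symm q hc hπ hw

include hc hπ in
/-- The seam data at a unit vector: `π (e u) = L u`, `π ∘ e` is differentiable at `u`, and
`d(π ∘ e)_u v = L v` for `v ⊥ u`. [folklore] -/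
private theorem seam_unit {u : EuclideanSpace ℝ (Fin 4)} (hu : ‖u‖ = 1) :
    π ((chartAt (EuclideanSpace ℝ (Fin 4)) q).symm u) = stereoTransfer (n := 4) q u ∧
      MDifferentiableAt (𝓡 4) (𝓡 4) (π ∘ (chartAt (EuclideanSpace ℝ (Fin 4)) q).symm) u ∧
      ∀ v : EuclideanSpace ℝ (Fin 4), ⟪v, u⟫ = 0 →
        mfderiv (𝓡 4) (𝓡 4) (π ∘ (chartAt (EuclideanSpace ℝ (Fin 4)) q).symm) u v =
          stereoTransfer (n := 4) q v := by
  have h := hasMFDerivAt_pi_chartAt_symm q hc hπ hu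
  refine ⟨pi_chartAt_symm_unit q hc hπ hu, h.mdifferentiableAt, fun v hv => ?_⟩
  rw [h.mfderiv]
  have hvmem : v ∈ (ℝ ∙ u)ᗮ := Submodule.mem_orthogonal_singleton_iff_inner_left.2 hv
  show stereoTransfer (n := 4) q ((ℝ ∙ u)ᗮ.reflection v) = _
  rw [Submodule.reflection_mem_subspace_eq_self hvmem]

end Transfer'

end Pair

/-! ### The registered helper -/

/-- **The genuine ball of `S⁴` and the chart around its complement** (antipodal stereographic
charts): a smooth embedding `e : ℝ⁴ → S⁴` of the whole model space, an open `U ⊇ S⁴ ∖ e(B⁴)` and a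
map `π : S⁴ → ℝ⁴`, `C^∞`, injective and with bijective differential on `U`, `π(U) ⊆ B⁴(2)`, whose
transition with `e` on the unit sphere is a linear isometry `L` of `ℝ⁴`: `π (e u) = L u` and
`d(π ∘ e)_u = L` on `u^⊥` (Hirsch 1976, §1.1: the transition of the stereographic atlas is
`x ↦ x/‖x‖²`, whose differential on the unit sphere is the reflection in `u^⊥`). [folklore] -/
theorem helper_antipodalChartPair :
    ∃ (e : EuclideanSpace ℝ (Fin 4) → Metric.sphere (0 : EuclideanSpace ℝ (Fin 5)) 1) (π : Metric.sphere (0 : EuclideanSpace ℝ (Fin 5)) 1 → EuclideanSpace ℝ (Fin 4)) (U : Set (Metric.sphere (0 : EuclideanSpace ℝ (Fin 5)) 1)) (L : EuclideanSpace ℝ (Fin 4) ≃ₗᵢ[ℝ] EuclideanSpace ℝ (Fin 4)), Manifold.IsSmoothEmbedding (𝓡 4) (𝓡 4) ∞ e ∧ IsOpen U ∧ (e '' Metric.ball (0 : EuclideanSpace ℝ (Fin 4)) 1)ᶜ ⊆ U ∧ ContMDiffOn (𝓡 4) (𝓡 4) ∞ π U ∧ Set.InjOn π U ∧ (∀ x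 ∈ U, Function.Bijective (mfderiv (𝓡 4) (𝓡 4) π x)) ∧ Set.MapsTo π U (Metric.ball (0 : EuclideanSpace ℝ (Fin 4)) 2) ∧ ∀ u : EuclideanSpace ℝ (Fin 4), ‖u‖ = 1 → π (e u) = L u ∧ MDifferentiableAt (𝓡 4) (𝓡 4) (π ∘ e) u ∧ ∀ v : EuclideanSpace ℝ (Fin 4), ⟪v, u⟫ = 0 → mfderiv (𝓡 4) (𝓡 4) (π ∘ e) u v = L v := by
  haveI : Fact (Module.finrank ℝ (EuclideanSpace ℝ (Fin 5)) = 4 + 1) := ⟨finrank_euclideanSpace_fin⟩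
  set q : Metric.sphere (0 : EuclideanSpace ℝ (Fin 5)) 1 := ⟨EuclideanSpace.single 0 1, by simp⟩
  obtain ⟨c, hc⟩ : ∃ c : EuclideanSpace ℝ (Fin 4) →L[ℝ] EuclideanSpace ℝ (Fin 4), ∀ y,
      c y = (4 : ℝ)⁻¹ • y := ⟨(4 : ℝ)⁻¹ • ContinuousLinearMap.id ℝ _, fun y => rfl⟩
  obtain ⟨π, hπ⟩ : ∃ π : Metric.sphere (0 : EuclideanSpace ℝ (Fin 5)) 1 → EuclideanSpace ℝ (Fin 4),
      ∀ x, π x = c (extChartAt (𝓡 4) (-q) x) := ⟨_, fun x => rfl⟩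
  refine ⟨(chartAt (EuclideanSpace ℝ (Fin 4)) q).symm, π,
    (chartAt (EuclideanSpace ℝ (Fin 4)) (-q)).source ∩ π ⁻¹' ball 0 (3 / 2), stereoTransfer (n := 4) q,
    isSmoothEmbedding_chartAt_symm q, isOpen_U q hπ, compl_image_ball_subset_U q hc hπ,
    (contMDiffOn_pi q hπ).mono inter_subset_left, (injOn_pi q hc hπ).mono inter_subset_left,
    fun x hx => bijective_mfderiv_pi q hc hπ hx.1, fun x hx => ?_, fun u hu => seam_unit q hc hπ hu⟩
  exact ball_subset_ball (by norm_num) hx.2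

end Summit.SmoothPoincare4.SmoothPoincare4.Theorems.OrigamiFoldExistence.StableSeamHost

end
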